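import Summits.ResolutionOfSingularities.ResolutionOfSingularities.Theorems.MarkedTransferCampaignW46StringReading
import Summits.ResolutionOfSingularities.ResolutionOfSingularities.Theorems.MarkedTransferCampaignW46ThreefoldsMonotone
import HarnessLib

/-!
# [OURS · L1 W4.6] The termination reductions PROVED ONCE FOR EVERY STRING READING `σ` (whole-∇; component-wise ∇-centred
# in a regime of bounded dimension) — OUR MEASURE v2, monotone off-centre shape (proofs)

Cell res-hironaka, LADDER-RESOLUTION rung L (D-0089), slot W4.6; seat res-L1-s46-pv-3 (gen 2). Host route MarkedTransfer,
host item `HypersurfaceOrderReductionDimLeThree` (stmt-16156); `--kind proof --supports` it. Companion of the statement module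
`MarkedTransferCampaignW46StringReading` (string readings `σ`, the five reading-generic shapes) and of `…ThreefoldsMeasure` /
`…ThreefoldsMonotone` (the component measure, the stalling lemma).

HONEST FRAMING. Everything below is OURS: pure logic over the campaign shapes plus the tree's order theory, topology and
blow-up library; NOTHING here is a statement of H. Hironaka's manuscript (2017-03-23, [Hironaka2017]) and nothing asserts
that any statement of it holds. All shapes are HYPOTHESES. AI review is weaker than expert review.

## What

For ANY string reading `σ` of the résumés of `N` (in particular (M) `readingM` and (M⁺) `readingMSucc`):
* WHOLE-∇: `σ.DecreaseShape → σ.StopsShape → σ.TopSingShape → σ.MonotoneShape → TerminatesWhole N Rd Rg`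
  (`StringReading.terminatesWhole_of_shapes`) — the top `σ`-strings strictly decrease along a whole-∇ run under the length
  bound `σ.len (R 0)` (tree `InvStringOrder.lexLT_no_infinite_descent_of_length_le`).
* COMPONENT-WISE (registered ∇-centred shape), regime inside `dimLE d`:
  `σ.DecreaseShape → σ.PrefixShape → σ.StopsShape → σ.TopSingShape → σ.MonotoneShape → TerminatesNabla N Rd Rg`
  (`StringReading.terminatesNabla_of_shapes`) — OUR MEASURE v2 (padded top `σ`-string, `compMeasure d ∇(E_k)`) with the
  Dershowitz–Manna order on the second coordinate (`isDershowitzMannaLT_compMeasure`, `no_stalling_descent_wf`).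
The (M) theorems of `…ThreefoldsMonotone` / `…ThreefoldsPadded` are the instances `σ = readingM`; the (M⁺) rung (ii) is
assembled in `MarkedTransferCampaignW46ThreefoldsSucc`.

References: `…StringReading`; Threefolds.lean v4/v5; `…ThreefoldsMeasure` (p484132), `…ThreefoldsMonotone` (p484419),
`…ThreefoldsPadded` (p481859); shared module v4 (p479675) + anchors v3 (p480427). [BaaderNipkow1998] §2.4 via
`InvStringOrder`; [DershowitzManna1979] via Mathlib; de Jong 1996 4.27 via `Resolution.componentsIn` [deJong1996].
H. Hironaka, ms. 2017-03-23, Th. 16.6 p.84, §16.3 p.87 — scope only, under adjudication, not cited as fact. [Hironaka2017]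
-/

noncomputable section

set_option linter.dupNamespace false -- mandated namespace of this single-conjunct summit

open CategoryTheory AlgebraicGeometry TopologicalSpace

namespace Summit.ResolutionOfSingularities.ResolutionOfSingularities.Theorems

namespace CampaignW46

open Literature.AlgebraicGeometry.Resolution
open Literature.AlgebraicGeometry.Hironaka2017
open Literature.AlgebraicGeometry.Hironaka2017.S02Preliminaries
open Literature.AlgebraicGeometry.Hironaka2017.Datum
open Literature.AlgebraicGeometry.Hironaka2017.S15ARSchemes
open Literature.AlgebraicGeometry.Hironaka2017.S16Proof
open Literature.AlgebraicGeometry.Hironaka2017.InvStringOrder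

universe u

variable {n : ℕ} {p : ℕ} [Fact p.Prime] {K : Type u} [Field K] [CharP K p]

/-- For a whole step (`D = ∇(E)` as sets) the strict transform `∇′` of `∇(E)` is empty (closure of `π⁻¹(∇ ∖ ∇)`).
[folklore] -/
theorem Step.strictTransformSet_eq_empty_of_whole {N : Notions.{u} n} {A A' : AmbientDatum p K} {E : IdealExponent A.Z}
    {R : Resume N A E} (s : Step R A') (hwhole : (s.D : Set A.Z) = (R.nabla : Set A.Z)) :
    strictTransformSet s.π (s.D : Set A.Z) (R.nabla : Set A.Z) = ∅ := by
  simp [strictTransformSet, hwhole]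

namespace StringReading

/-! ## One whole step: the top string drops -/

section WholeStep

variable {N : Notions.{u} n} {Rd : Reading p K N} {Rg : Regime p K} (σ : StringReading p K N)
variable {A A' : AmbientDatum p K} {E : IdealExponent A.Z} {R : Resume N A E}

/-- THE ONE-STEP DESCENT for a whole step under the reading `σ`: at every closed `η′ ∈ ∇(E′)` the `σ`-string of `R′` is
strictly below the top `σ`-string of `R`, and `σ.len R′ ≤ σ.len R`. Over the centre (`∇′ = ∅`): `DecreaseShape` and (T1).
Off the centre: `π η′ ∈ Sing(E) ∖ ∇(E)` is closed, (T2-Sing) puts its string strictly below the top, and `MonotoneShape`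
says the string upstairs is not above it (`lexLT_of_not_lexLT_of_lexLT`). [folklore] -/
theorem descent_of_whole (hD : σ.DecreaseShape Rd Rg) (hM : σ.StopsShape Rd Rg) (hL : σ.MonotoneShape Rd Rg)
    (hRg : Rg A E) (hRd : Rd A E R) (s : Step R A') (hwhole : (s.D : Set A.Z) = (R.nabla : Set A.Z)) {η : A.Z}
    (hT1 : ∀ ξ : A.Z, ξ ∈ Literature.AlgebraicGeometry.Hironaka2017.S02Preliminaries.closedPoints A.Z →
      ξ ∈ (R.nabla : Set A.Z) → σ.str R ξ = σ.str R η)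
    (hT2 : ∀ ξ : A.Z, ξ ∈ Literature.AlgebraicGeometry.Hironaka2017.S02Preliminaries.closedPoints A.Z →
      ξ ∈ E.sing → ξ ∉ (R.nabla : Set A.Z) → InvString.LexLT (σ.str R ξ) (σ.str R η))
    {E' : IdealExponent A'.Z} (hE' : E' = s.E') (R' : Resume N A' E') (hRd' : Rd A' E' R') {η' : A'.Z}
    (hη'n : η' ∈ (R'.nabla : Set A'.Z))
    (hη' : η' ∈ Literature.AlgebraicGeometry.Hironaka2017.S02Preliminaries.closedPoints A'.Z) :
    InvString.LexLT (σ.str R' η') (σ.str R η) ∧ σ.len R' ≤ σ.len R := by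
  subst hE'
  have hζ := s.apply_mem_closedPoints hη'
  have hζs : s.π η' ∈ E.sing := s.apply_mem_sing (R'.nabla_subset_sing hη'n)
  refine ⟨?_, hM A E R hRg hRd A' s R' hRd'⟩
  by_cases hD' : s.π η' ∈ (s.D : Set A.Z)
  · have hnot : η' ∉ strictTransformSet s.π (s.D : Set A.Z) (R.nabla : Set A.Z) := by
      rw [s.strictTransformSet_eq_empty_of_whole hwhole]
      exact Set.notMem_empty _
    have h127 := hD A E R hRg hRd A' s R' hRd' η' hη' hD' hnot
    have hin : s.π η' ∈ (R.nabla : Set A.Z) := by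
      rw [← hwhole]
      exact hD'
    rwa [hT1 _ hζ hin] at h127
  · have hmono := hL A E R hRg hRd A' s R' hRd' η' hη' hD'
    have hnot : s.π η' ∉ (R.nabla : Set A.Z) := by
      rw [← hwhole]
      exact hD'
    exact lexLT_of_not_lexLT_of_lexLT hmono (hT2 _ hζ hζs hnot)

/-- **WHOLE-∇ REDUCTION FOR EVERY STRING READING (general regime).** `σ.DecreaseShape → σ.StopsShape → σ.TopSingShape →
σ.MonotoneShape → TerminatesWhole N Rd Rg`: along a whole-∇ run the top `σ`-strings strictly decrease and their lengths
are bounded by the initial one, which the tree's `lexLT_no_infinite_descent_of_length_le` forbids. [folklore] -/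
theorem terminatesWhole_of_shapes (hD : σ.DecreaseShape Rd Rg) (hM : σ.StopsShape Rd Rg) (hT : σ.TopSingShape Rd Rg)
    (hL : σ.MonotoneShape Rd Rg) : TerminatesWhole N Rd Rg := by
  intro r hw hRg
  choose η hηn hηc hT1 hT2 using fun k => hT (r.A k) (r.E k) (r.R k) (hRg k) (r.reads k)
  have hstep : ∀ k, InvString.LexLT (σ.str (r.R (k + 1)) (η (k + 1))) (σ.str (r.R k) (η k)) ∧
      σ.len (r.R (k + 1)) ≤ σ.len (r.R k) :=
    fun k => σ.descent_of_whole hD hM hL (hRg k) (r.reads k) (r.step k) (hw k) (hT1 k) (hT2 k) (r.E_succ k)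
      (r.R (k + 1)) (r.reads (k + 1)) (hηn (k + 1)) (hηc (k + 1))
  have hm : ∀ k, σ.len (r.R k) ≤ σ.len (r.R 0) := by
    intro k
    induction k with
    | zero => exact le_rfl
    | succ k ih => exact (hstep k).2.trans ih
  refine lexLT_no_infinite_descent_of_length_le (σ.len (r.R 0)) (fun k => σ.str (r.R k) (η k)) (fun k => ?_)
    fun k => (hstep k).1
  rw [σ.length_str]
  exact hm k

end WholeStep

/-! ## One ∇-step: the top string does not increase, and if it stalls `∇(E′) ⊆ ∇′` -/

section NablaStep

variable {N : Notions.{u} n} {Rd : Reading p K N} {Rg : Regime p K} (σ : StringReading p K N)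
variable {A A' : AmbientDatum p K} {E : IdealExponent A.Z} {R : Resume N A E}

/-- POINTWISE COMPARISON across an admitted step under the reading `σ`. Fix a closed `η` realising (T1)/(T2-Sing) of
`TopSingShape` for `R` and a bound `M ≥ σ.len R`. For every closed `ξ′` of `Z′` whose image is singular for `E` and every
résumé `R′` of the transform read by `Rd`: (a) the padded `σ`-string of `R′` at `ξ′` is `≤` the top string of `R`; (b) if
they are EQUAL then `ξ′ ∈ ∇′`. Cases: `ξ′ ∈ ∇′` over the centre — `PrefixShape` makes the new string a prefix of the top
string (`not_lexLT_take`); over the centre off `∇′` — `DecreaseShape`; off the centre — `MonotoneShape` and (T1)/(T2-Sing)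
downstairs. [folklore] -/
theorem padFin_le_of_step (hD : σ.DecreaseShape Rd Rg) (hP : σ.PrefixShape Rd Rg) (hM : σ.StopsShape Rd Rg)
    (hL : σ.MonotoneShape Rd Rg) (hRg : Rg A E) (hRd : Rd A E R) (s : Step R A') {η : A.Z}
    (hT1 : ∀ ξ : A.Z, ξ ∈ Literature.AlgebraicGeometry.Hironaka2017.S02Preliminaries.closedPoints A.Z →
      ξ ∈ (R.nabla : Set A.Z) → σ.str R ξ = σ.str R η)
    (hT2 : ∀ ξ : A.Z, ξ ∈ Literature.AlgebraicGeometry.Hironaka2017.S02Preliminaries.closedPoints A.Z →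
      ξ ∈ E.sing → ξ ∉ (R.nabla : Set A.Z) → InvString.LexLT (σ.str R ξ) (σ.str R η))
    {M : ℕ} (hMm : σ.len R ≤ M)
    {E' : IdealExponent A'.Z} (hE' : E' = s.E') (R' : Resume N A' E') (hRd' : Rd A' E' R') {ξ' : A'.Z}
    (hξ' : ξ' ∈ Literature.AlgebraicGeometry.Hironaka2017.S02Preliminaries.closedPoints A'.Z)
    (hξs : s.π ξ' ∈ E.sing) :
    padFin M (σ.str R' ξ') ≤ padFin M (σ.str R η) ∧
      (padFin M (σ.str R' ξ') = padFin M (σ.str R η) →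
        ξ' ∈ strictTransformSet s.π (s.D : Set A.Z) (R.nabla : Set A.Z)) := by
  subst hE'
  have hζ := s.apply_mem_closedPoints hξ'
  have hM' : σ.len R' ≤ M := (hM A E R hRg hRd A' s R' hRd').trans hMm
  have hlenη : (σ.str R η).length ≤ M := by rw [σ.length_str]; exact hMm
  have hlenξ' : (σ.str R' ξ').length ≤ M := by rw [σ.length_str]; exact hM'
  have hlenζ : (σ.str R (s.π ξ')).length ≤ M := by rw [σ.length_str]; exact hMm
  by_cases hDζ : s.π ξ' ∈ (s.D : Set A.Z)
  · have hin : s.π ξ' ∈ (R.nabla : Set A.Z) := s.centre.subset_nabla hDζ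
    have eζ : σ.str R (s.π ξ') = σ.str R η := hT1 _ hζ hin
    by_cases hDP : ξ' ∈ strictTransformSet s.π (s.D : Set A.Z) (R.nabla : Set A.Z)
    · -- on `∇′`: the new string is a prefix of the top string
      have htake : σ.str R' ξ' = (σ.str R η).take (σ.len R') := by
        rw [← eζ]
        exact hP A E R hRg hRd A' s R' hRd' ξ' hξ' hDP
      have hle : padFin M (σ.str R' ξ') ≤ padFin M (σ.str R η) := by
        rw [htake]
        by_contra hlt
        rw [not_le] at hlt
        have hlen2 : ((σ.str R η).take (σ.len R')).length ≤ M :=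
          (List.length_take_le' _ _).trans hlenη
        exact not_lexLT_take (σ.str R η) (σ.len R') ((lexLT_iff_padFin_lt hlenη hlen2).mpr hlt)
      exact ⟨hle, fun _ => hDP⟩
    · -- over the centre, off `∇′`: Eq. (127)
      have h127 := hD A E R hRg hRd A' s R' hRd' ξ' hξ' hDζ hDP
      rw [eζ] at h127
      have hlt : padFin M (σ.str R' ξ') < padFin M (σ.str R η) := (lexLT_iff_padFin_lt hlenξ' hlenη).mp h127
      exact ⟨hlt.le, fun heq => absurd heq hlt.ne⟩
  · -- off the centre: not above the string downstairs
    have hmono := hL A E R hRg hRd A' s R' hRd' ξ' hξ' hDζ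
    have hle0 : padFin M (σ.str R' ξ') ≤ padFin M (σ.str R (s.π ξ')) := by
      rw [lexLT_iff_padFin_lt hlenζ hlenξ', not_lt] at hmono
      exact hmono
    by_cases hin : s.π ξ' ∈ (R.nabla : Set A.Z)
    · have eζ : σ.str R (s.π ξ') = σ.str R η := hT1 _ hζ hin
      rw [eζ] at hle0
      exact ⟨hle0, fun _ => strictTransformSet.preimage_diff_subset s.π _ _ ⟨hin, hDζ⟩⟩
    · have hlt' : padFin M (σ.str R (s.π ξ')) < padFin M (σ.str R η) :=
        (lexLT_iff_padFin_lt hlenζ hlenη).mp (hT2 _ hζ hξs hin)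
      have hlt := hle0.trans_lt hlt'
      exact ⟨hlt.le, fun heq => absurd heq hlt.ne⟩

/-- IF THE TOP `σ`-STRING DOES NOT DROP, `∇(E′) ⊆ ∇′`: with closed `η`, `η′` realising (T1)/(T2-Sing) for `R` and (T1) for
`R′`, if the padded top strings agree then every closed point of `∇(E′)` lies in `∇′` (pointwise comparison), hence so
does the closed set `∇(E′)` (`Z′` Jacobson). [folklore] -/
theorem nabla_subset_strictTransformSet_of_padFin_eq (hD : σ.DecreaseShape Rd Rg) (hP : σ.PrefixShape Rd Rg)
    (hM : σ.StopsShape Rd Rg) (hL : σ.MonotoneShape Rd Rg) (hRg : Rg A E) (hRd : Rd A E R) (s : Step R A') {η : A.Z}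
    (hT1 : ∀ ξ : A.Z, ξ ∈ Literature.AlgebraicGeometry.Hironaka2017.S02Preliminaries.closedPoints A.Z →
      ξ ∈ (R.nabla : Set A.Z) → σ.str R ξ = σ.str R η)
    (hT2 : ∀ ξ : A.Z, ξ ∈ Literature.AlgebraicGeometry.Hironaka2017.S02Preliminaries.closedPoints A.Z →
      ξ ∈ E.sing → ξ ∉ (R.nabla : Set A.Z) → InvString.LexLT (σ.str R ξ) (σ.str R η))
    {M : ℕ} (hMm : σ.len R ≤ M)
    {E' : IdealExponent A'.Z} (hE' : E' = s.E') (R' : Resume N A' E') (hRd' : Rd A' E' R') {η' : A'.Z}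
    (hT1' : ∀ ξ' : A'.Z, ξ' ∈ Literature.AlgebraicGeometry.Hironaka2017.S02Preliminaries.closedPoints A'.Z →
      ξ' ∈ (R'.nabla : Set A'.Z) → σ.str R' ξ' = σ.str R' η')
    (heq : padFin M (σ.str R' η') = padFin M (σ.str R η)) :
    (R'.nabla : Set A'.Z) ⊆ strictTransformSet s.π (s.D : Set A.Z) (R.nabla : Set A.Z) := by
  subst hE'
  haveI := A'.smooth
  haveI : JacobsonSpace A'.Z := LocallyOfFiniteType.jacobsonSpace A'.hom
  have h1 : ∀ ξ' : A'.Z, ξ' ∈ Literature.AlgebraicGeometry.Hironaka2017.S02Preliminaries.closedPoints A'.Z →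
      ξ' ∈ (R'.nabla : Set A'.Z) → ξ' ∈ strictTransformSet s.π (s.D : Set A.Z) (R.nabla : Set A.Z) := by
    intro ξ' hc hn
    refine (σ.padFin_le_of_step hD hP hM hL hRg hRd s hT1 hT2 hMm rfl R' hRd' hc
      (s.apply_mem_sing (R'.nabla_subset_sing hn))).2 ?_
    rw [hT1' ξ' hc hn]
    exact heq
  have hcl : closure ((R'.nabla : Set A'.Z) ∩ _root_.closedPoints A'.Z) = (R'.nabla : Set A'.Z) :=
    closure_inter_closedPoints R'.nabla.isClosed
  rw [← hcl]
  exact closure_minimal (fun x hx => h1 x hx.2 hx.1) (strictTransformSet.isClosed _ _ _)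

end NablaStep

/-! ## The component-wise reduction for every string reading, in a regime of bounded dimension -/

section Reduction

variable {N : Notions.{u} n} {Rd : Reading p K N} {Rg : Regime p K} (σ : StringReading p K N)

/-- Transport of `StopsShape` along the bookkeeping equation `E_{k+1} = E_k′` of a run. [folklore] -/
theorem stops_le (hM : σ.StopsShape Rd Rg) {A A' : AmbientDatum p K} {E : IdealExponent A.Z} {R : Resume N A E}
    (hRg : Rg A E) (hRd : Rd A E R) (s : Step R A') {E' : IdealExponent A'.Z} (hE' : E' = s.E') (R' : Resume N A' E')
    (hRd' : Rd A' E' R') : σ.len R' ≤ σ.len R := by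
  subst hE'
  exact hM A E R hRg hRd A' s R' hRd'

/-- **COMPONENT-WISE REDUCTION FOR EVERY STRING READING.** Let the regime `Rg` lie inside `dimLE d`. If for states in `Rg`
(notion instance `N`, reading `Rd`) the `σ`-shapes hold — Eq. (127) off `∇′` over the centre (`DecreaseShape`), the prefix
form of Eq. (128) on `∇′` (`PrefixShape`), `m′ ≤ m` (`StopsShape`), terminal plat = top `σ`-stratum of `Sing(E)`
(`TopSingShape`), strings not going up off the centre (`MonotoneShape`) — then there is NO infinite ∇-centred run inside `Rg`
(`TerminatesNabla`). OUR MEASURE v2: (padded top `σ`-string, `compMeasure d ∇(E_k)`), Dershowitz–Manna in the second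
coordinate; as `terminatesNabla_of_decrease_mono` (the instance `σ = readingM`). [folklore] -/
theorem terminatesNabla_of_shapes {d : ℕ} (hdim : ∀ A E, Rg A E → Regime.dimLE d A E) (hD : σ.DecreaseShape Rd Rg)
    (hP : σ.PrefixShape Rd Rg) (hM : σ.StopsShape Rd Rg) (hT : σ.TopSingShape Rd Rg) (hL : σ.MonotoneShape Rd Rg) :
    TerminatesNabla N Rd Rg := by
  intro r hRg
  choose η hηn hηc hT1 hT2 using fun k => hT (r.A k) (r.E k) (r.R k) (hRg k) (r.reads k)
  have hmstep : ∀ k, σ.len (r.R (k + 1)) ≤ σ.len (r.R k) := fun k =>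
    σ.stops_le hM (hRg k) (r.reads k) (r.step k).toStep (r.E_succ k) (r.R (k + 1)) (r.reads (k + 1))
  have hm : ∀ k, σ.len (r.R k) ≤ σ.len (r.R 0) := by
    intro k
    induction k with
    | zero => exact le_rfl
    | succ k ih => exact (hmstep k).trans ih
  have hηs : ∀ k, (r.step k).toStep.π (η (k + 1)) ∈ (r.E k).sing := by
    intro k
    have h1 : η (k + 1) ∈ (r.E (k + 1)).sing := (r.R (k + 1)).nabla_subset_sing (hηn (k + 1))
    rw [r.E_succ k] at h1
    exact (r.step k).toStep.apply_mem_sing h1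
  have hfin : ∀ k, (componentsIn ((r.R k).nabla : Set (r.A k).Z)).Finite := fun k => by
    haveI := (r.A k).smooth
    haveI := (r.A k).quasiCompact
    haveI : IsLocallyNoetherian (r.A k).Z := LocallyOfFiniteType.isLocallyNoetherian (r.A k).hom
    haveI : CompactSpace (r.A k).Z := QuasiCompact.compactSpace_of_compactSpace (r.A k).hom
    haveI : IsNoetherian (r.A k).Z := {}
    exact componentsIn.finite _
  have hcoh : ∀ (k) (x : (r.A k).Z), Order.coheight x ≤ d := fun k =>
    (topologicalKrullDim_le_iff_forall_coheight_le _ d).mp (hdim _ _ (hRg k))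
  have hstep : ∀ k,
      padFin (σ.len (r.R 0)) (σ.str (r.R (k + 1)) (η (k + 1))) ≤ padFin (σ.len (r.R 0)) (σ.str (r.R k) (η k)) ∧
        (padFin (σ.len (r.R 0)) (σ.str (r.R (k + 1)) (η (k + 1))) = padFin (σ.len (r.R 0)) (σ.str (r.R k) (η k)) →
          Multiset.IsDershowitzMannaLT (compMeasure d ((r.R (k + 1)).nabla : Set (r.A (k + 1)).Z))
            (compMeasure d ((r.R k).nabla : Set (r.A k).Z))) := by
    intro k
    refine ⟨(σ.padFin_le_of_step hD hP hM hL (hRg k) (r.reads k) (r.step k).toStep (hT1 k) (hT2 k) (hm k)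
      (r.E_succ k) (r.R (k + 1)) (r.reads (k + 1)) (hηc (k + 1)) (hηs k)).1, fun heq => ?_⟩
    have hsub := σ.nabla_subset_strictTransformSet_of_padFin_eq hD hP hM hL (hRg k) (r.reads k) (r.step k).toStep
      (hT1 k) (hT2 k) (hm k) (r.E_succ k) (r.R (k + 1)) (r.reads (k + 1)) (hT1 (k + 1)) heq
    haveI : IsIso ((r.step k).toStep.π ∣_
        ⟨((r.step k).toStep.D : Set (r.A k).Z)ᶜ, (r.step k).toStep.D.isClosed.isOpen_compl⟩) :=
      (r.step k).toStep.blowup.isIso_morphismRestrict (by simpa using disjoint_compl_left)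
    exact isDershowitzMannaLT_compMeasure (r.step k).toStep.π (r.step k).toStep.D.isClosed (r.R k).nabla.isClosed
      (hfin k) (r.step k).component.mem_componentsIn (r.R (k + 1)).nabla.isClosed (hfin (k + 1)) hsub
      (hcoh (k + 1))
  exact no_stalling_descent_wf Multiset.wellFounded_isDershowitzMannaLT
    (fun k => padFin (σ.len (r.R 0)) (σ.str (r.R k) (η k)))
    (fun k => compMeasure d ((r.R k).nabla : Set (r.A k).Z)) (fun k => (hstep k).1) fun k => (hstep k).2

end Reduction

end StringReading

end CampaignW46

end Summit.ResolutionOfSingularities.ResolutionOfSingularities.Theorems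

end
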